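import Mathlib
import HarnessLib
import HarnessLib.Audit
import Summits.RiemannHypothesis.Statement
import Summits.RiemannHypothesis.RiemannHypothesis.Theorems.Splittings.ScrewLatticeContinuationB
import HarnessLib.Audit.Status.Attr

/-!
Route: ScrewDustWall

# Route ScrewDustWall — X-11 DUST WALL — CEIL(1) and a totally disconnected aliased-pole wall imply
RH via point-component flux

D-0145 LINE of seat rh-idea-1 (technique: splitting / criterion search; bears_on LADDER-RH rung S-P
«SPLIT survivor rows X-10 ⊇ X-9 and the
search for NEW splits (screw §19 ff.)», column SCREW §19–20). It suffices to show X = X-11: CEIL(1)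
∧ TD(1) ⟹ RH, where CEIL(1) =
`LatticeCeiling 1` (sub-exponential growth of the screw function Ψ on the progression ℕ, the
declared RESIDUAL, RH-strength) and the NEW
zero-side conjunct TD(1) = «DUST WALL»: the closure of the aliased pole field `aliasedPoleSet 1`
(folded far zeros `e^{∓(ρ-1/2)}`, `Re ρ ≠ 1/2`)
is TOTALLY DISCONNECTED inside the unit disc. X is assembled from one RH-free, ζ-free kernel theorem
`PointComponentInvisible` (a pole that is
a point-component of the wall is never adherent to the origin's component of the regular set) and
one classical plane-topology support
`DustDoesNotSeparate`. RH ⟹ CEIL(1) ∧ TD(1) is in the tree (`latticeCeiling`-side and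
`aliasedPoleSet_eq_empty_of_rh`), so X-11 is an
RH-equivalence CEIL ∧ TD ⟺ RH whose attacked conjunct is TD and whose provable content is the kernel
theorem. Nothing here bears on the truth of RH.
Lean: `Summit.RiemannHypothesis.RiemannHypothesis.Theses.ScrewDustWall.PointComponentInvisible →
Summit.RiemannHypothesis.RiemannHypothesis.Theses.ScrewDustWall.DustDoesNotSeparate →
Summit.RiemannHypothesis.RiemannHypothesis.Theses.ScrewDustWall.DustWall →
Summit.RiemannHypothesis.RiemannHypothesis.Theses.ScrewDustWall.Ceil → Summit.RiemannHypothesis`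

## Assembly
Pure logic plus the tree dictionary, kernel-checked in the seat folder (Sketch.lean
`ScrewDustWall.closes`, 45 lines, rc 0, no sorry):
by_contra ¬RH ⟹ `aliasedPoleSet_nonempty_of_not_rh one_pos` gives a pole p; DustWall ⟹ the component
of p in the wall is {p}
(`connectedComponentIn_subset`, `isPreconnected_connectedComponentIn`) and the wall has empty
interior so p ∈ closure(𝔻 ∖ T);
DustDoesNotSeparate ⟹ 𝔻 ∖ T ⊆ component of 0 (`IsPreconnected.subset_connectedComponentIn`,
`zero_mem_ball_diff_closure`);
PointComponentInvisible with c := coeff, u := mult 1, F := latticeGF 1, r₀ := e^{-1/2}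
(`summable_norm_coeff`, `re_coeff_neg`, `mult_ne_zero`,
`differentiableOn_latticeGF` (uses Ceil), `exp_neg_half_le_norm_of_mem`, `latticeGF_eq_borel`) ⟹
contradiction. The deciding theorem is
`closes (h₁ h₂ h₃ h₄) (hA : Assembly) := hA h₁ h₂ h₃ h₄`; the Assembly item is PROVABLE NOW (proof
text attached as evidence at birth).

Rationale: WHY THIS LINE. Mechanism: under CEIL(h) the lattice generating function `latticeGF h` is holomorphic
on 𝔻 and equals the sign-definite ℓ¹ Borel series
`∑' ρ term (coeff ρ) (mult h ρ)` near 0 (tree: `differentiableOn_latticeGF`, `latticeGF_eq_borel`);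
the §19 WALLS theorem
(`ScrewBorel.not_mem_closure_of_isolated`) says an ISOLATED pole cannot be adherent to the region of
agreement, and §20 replaced "isolated"
by "small circles" (`ScrewBorelFlux.false_of_small_circles`, flux quantisation). This line imports
plane topology (Zoretti / Moore:
component = quasi-component in the compact set `closure S ∩ closedBall r`, so a POINT-COMPONENT pole
has arbitrarily small neighbourhoods
bounded by grid cycles missing the wall — Whyburn–Duda *Dynamic Topology*
[galaxy:panama:357169480335412]) and the non-separation theorem
for closed zero-dimensional plane sets ([corpus:paper:arxiv-math_0303261 p7], Hurewicz–Wallman) to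
replace "a small CIRCLE misses the wall"
by "a small CYCLE misses the wall": the obstruction in the one-circle divisor-ring model B16′
(`exists_blind_model_discrete`, card
SPLIT-screw-bridge §20.P) is SEPARATION by a continuum, not metric size. Hence the next survivor
split X-11 ⊇ X-10 ⊇ X-9: TW(h) (length-zero
wall, g16's L1) ⟹ TD(h) ⟹ (¬ CountableClosure excluded), each strictly, and TD names a searchable
object (a continuum inside the folded
far-zero wall) that no listed route (L1 ThinWall = Hausdorff length; L2 IntegerScrew floors;
LiTailLaguerre; JensenChainBand; NymanBeurlingTail)
uses. The negatives index (ShiftedResolvent 15969/15970, CharacterSums 16980, UniversalFactor 2575;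
screw-neg PivotFloor/LogFloorTail/
ZeroDeficitTail) concerns other objects; nothing here restates them.

RANKED CRUXES. #2 PointComponentInvisible (crux) — RH-free, ζ-free kernel theorem (the provable
content of the line). For a sign-definite ℓ¹ Borel family (Σ‖c_i‖ < ∞, Re c_i < 0, u_i ≠ 0) and F
holomorphic on 𝔻 agreeing with the Borel series Σ term(c_i,u_i) on a small ball around 0 free of
poles: if an inside pole p ∈ poleSet u is a POINT-COMPONENT of the wall closure(poleSet u) ∩ 𝔻, then
p is not adherent to the connected component of 0 in 𝔻 ∖ closure(poleSet u). Proof plan: F = Borel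
sum on that component (tree `eqOn_of_preconnected`); Zoretti/Šura-Bura in the compact set
closure(poleSet u) ∩ closedBall((1+‖p‖)/2) gives clopen pieces U ∋ p of diameter → 0; the outer
boundary cycle γ of the grid-square hull of U misses the wall, lies in the 0-component (it is
crossed by a path from a point of the component near p to 0), so ∮_γ F = 0 (squares, Mathlib
rectangle Cauchy) while termwise ∮_γ = −2πi Σ_{q ∈ S ∩ int γ} q·C_q (tree `circleIntegral_term`
pattern, uniform convergence off the wall); letting diam → 0, Tannery (Σ|C_q| ≤ Σ‖c_i‖) gives p·C_p
= 0, contradicting Re C_p < 0 (tree `re_tsum_poleCoeff_neg`) and p ≠ 0. [difficulty: L] (why it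
might fail: A point-component admits small wall-avoiding grid cycles only via component =
quasi-component in a COMPACT piece of the wall (closedBall r, r<1); Mathlib has no cycle/winding
residue calculus — the chain bookkeeping (internal edges cancel) is the real cost.)
[galaxy:panama:357169480335412, corpus:book:ross2002-generalized-analytic-continuation p36-37,
doi:10.1090/ulect/025]
#3 DustWall (crux) — The zero-side conjunct TD(1) «DUST WALL» (the searchable object of the split):
the closure of the aliased pole field at step h = 1 — the set of e^{∓(ρ−1/2)} inside 𝔻 over
nontrivial zeros ρ with Re ρ ≠ 1/2 — meets the open unit disc in a totally disconnected set.
RH-implied (vacuous: `aliasedPoleSet_eq_empty_of_rh`); also implied by «finitely many off-line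
zeros», by CountableClosure (X-9) and by ThinWall (X-10, length zero ⟹ totally disconnected), so
X-11 ⊇ X-10 ⊇ X-9. It is NOT claimed provable; it is the conjunct a zero-search instrument can
address (a continuum of folded far zeros is the object to exclude). [difficulty: open-problem] (why
it might fail: False iff off-line zeros exist AND their folded images accumulate along a
non-degenerate continuum inside 𝔻 (infinitely many far zeros with |Re ρ − 1/2| bounded below,
clustering in angle); the kernel allows exactly this (B16′ circle wall), ζ-side nothing is known.)
[corpus:book:ross2002-generalized-analytic-continuation p33, doi:10.1090/ulect/025]
#9 DustDoesNotSeparate (support) — Classical plane topology (Sierpiński–Mazurkiewicz–Menger; «a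
closed zero-dimensional set does not separate a planar domain»): if T ⊆ ℂ is closed and T ∩ 𝔻 is
totally disconnected then 𝔻 ∖ T is preconnected. Needed only to identify the origin's component with
all of 𝔻 ∖ T so that every aliased pole is adherent to it. Not in Mathlib; provable via clopen
partitions of compact pieces + grid-polygon hulls + Janiszewski-type gluing, or via path-lifting
around finitely many small polygonal blobs. [difficulty: M] [corpus:paper:arxiv-math_0303261 p7,
corpus:paper:arxiv-1311.5122 p16]
#9 Ceil (support) — RESIDUAL conjunct (declared, NOT attacked by this line; RH-strength inside the
real-weight zero-side class by the blind models B14/B16/B16′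
`ScrewLatticeWolffModel.exists_blind_model` / `exists_blind_model_discrete`): CEIL(1) =
LatticeCeiling 1, i.e. for every ε > 0 the screw function satisfies |Ψ(k)| ≤ K_ε e^{εk} on k ∈ ℕ. RH
⟹ CEIL(1) is in the tree. Same decl as g16's L1 residual up to the choice h = 1 (dedup by signature
intended). [difficulty: open-problem] [corpus:book:ross2002-generalized-analytic-continuation p33]

TWO-LAYER PLAN. PointComponentInvisible ⇐ (P1) «grid-cycle residue»: for a finite union of closed
grid squares inside 𝔻 whose boundary cycle misses the wall, ∮ over the outer boundary of F = 0 and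
of the Borel sum = −2πi Σ_{enclosed poles} q·C_q → (P2) «Zoretti hull»: a point-component pole has
such hulls of diameter → 0 whose outer boundary lies in the origin's component →
PointComponentInvisible by Tannery (pattern of tree `false_of_small_circles`). DustDoesNotSeparate ⇐
compact case (T ∩ closedBall r) + exhaustion.

KILL CRITERIA. Refutation of PointComponentInvisible (a kernel-class model — Wolff/divisor-ring
type, constructors `ScrewLatticeWolffData/Model` — with a point-component pole adherent to Ω₀ and F
holomorphic) closes the route `refuted:PointComponentInvisible` and kills the mechanism. Refutation
of DustWall is ¬RH-type information (off-line zeros along a continuum): closes the route but is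
itself a discovery. A proof elsewhere that TD(h) adds nothing to CEIL(h) inside the zero-side class
(a blind model with totally disconnected wall — this would contradict
PointComponentInvisible+DustDoesNotSeparate, so it cannot coexist) would retire the split. If g16's
L1 (ThinWall) closes its attacked conjunct, X-11 is implied but not mooted (TD is weaker than TW).

NOT DECOMPOSED YET. The cycle/residue calculus for grid polygons (layer-2 child P1), the
Zoretti/Šura-Bura clopen-neighbourhood lemma in Lean (P2), and the compact-exhaustion proof of
DustDoesNotSeparate are deliberately not filed: they are prover-side splits once
PointComponentInvisible is claimed. No quantitative version (rate in Tannery) is needed.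

CHEAPEST FALSIFIER. (i) Costume/tautology: `#h21_crux_probe` on all four binders with summit :=
Summit.RiemannHypothesis — ran 2026-08-27T20:4xZ: PointComponentInvisible CLEAN (P3 battery timeout,
90 s rerun logged in NOTES), DustDoesNotSeparate CLEAN, DustWall CLEAN, Ceil CLEAN (no binder
implies RH cheaply; RH ⟹ DustWall is the informational converse, expected for a conjunct). (ii) The
instrument row that would refute the key lemma: run the B16′ divisor-ring constructor
(`exists_blind_model_discrete`) and the B14/B16 Wolff constructors and check whether any blind model
has a wall with a point-component pole adherent to Ω₀ — by PointComponentInvisible none can; B16′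
walls are circles ∪ isolated-free arcs (no point components on Ω₀'s side), B14/B16 walls are the
whole annulus closure. (iii) For DustWall alone: «finitely many off-line zeros» is a consistent
scenario in which DustWall holds and RH fails — so DustWall ⇏ RH by itself (T1 separating scenario),
and CEIL is genuinely load-bearing.

NUMBERS. h = 1 fixed for the conjunct and the residual (any fixed h > 0 would do; CEIL(h) for one h
is already RH-strength). Pole depth: every aliased pole has e^{-h/2} ≤ ‖p‖ < 1
(`exp_neg_half_le_norm_of_mem`), so r₀ = e^{-1/2} ≈ 0.6065 is pole-free.

DEFINITION REQUESTS. None: `IsTotallyDisconnected`, `connectedComponentIn`, `Metric.ball`, `closure`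
are Mathlib; `poleSet`, `term`, `aliasedPoleSet`, `LatticeCeiling`, `latticeGF`, `coeff`, `mult` are
tree decls (Theorems/Splittings/ScrewBorelContinuationA–C, ScrewLatticeContinuationA–B).

Novelty: Searches (2026-08-27): lit search --hybrid "Borel series … poles accumulating on a totally
disconnected set analytic continuation" (8 docs; nearest held:
book:ross2002-generalized-analytic-continuation, grep 'totally disconnected|Zoretti|porous' → 0
lines; its ch. 4 pp33–37 = Wolff example, Bonsall Prop 4.2.9, Brown–Shields–Zeller Thm 4.2.12 on
dominating sequences); lit search '"Zoretti"' --source local (6 docs, historical + arXiv:2212.02984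
p15); lit search '"totally disconnected" "does not separate"' --source local (6 docs:
arXiv:math/0303261 p7, arXiv:1311.5122 p16); lit galaxy search "Zoretti" --star all (14 rows; pdf:
arXiv:1911.06619 Ntalampekos; panama in-book hit Whyburn–Duda Dynamic Topology 357169480335412);
ledger negatives --problem RiemannHypothesis (4 refuted statements, none on Ψ/aliased poles); tree
rg over Theorems/Splittings (isolated / small-circles / length dichotomy only).
Nearest prior art found: tree §19–§20 (`ScrewBorel.not_mem_closure_of_isolated`,
`ScrewBorelFlux.false_of_small_circles`, pending `ScrewLatticeThinWall` = g16 L1) and Ross–Shapiro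
doi:10.1090/ulect/025 ch. 4 (Borel-series non-continuation needs dominating/nontangentially dense
poles).
Delta: replaces the metric smallness of the wall (isolated / circles / Hausdorff length zero) by the
purely topological «no continuum» via Zoretti cycles, giving a strictly larger survivor split X-11 ⊇
X-10 whose conjunct is a new searchable object, and isolates the provable content as one ζ-free
kernel t  [refs: 10.1090/ulect/025, 2212.02984, math/0303261, 1311.5122, 1911.06619, book:ross2002-generalized-analytic-continuation, doi:10.1090/ulect/025]

Barriers (technique_class: splitting, criterion-search, borel-continuation): - technique_class: splitting, criterion-search, borel-continuation
- Literature.Barriers.RiemannHypothesis.DavenportHeilbronn: outside — the line proves no zero-free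
statement; it is a criterion CEIL ∧ TD ⟹ RH through the explicit-formula dictionary of ζ itself
(tree `latticeGF_eq_borel`); for a Davenport–Heilbronn function the analogue of CEIL fails (off-line
zeros make Ψ_DH grow exponentially on ℕ unless blind cancellation), so no contradiction with DH
zeros arises.
- Literature.Barriers.RiemannHypothesis.BrouckeDebruyneRevesz2023_thm13: outside (Beurling-type
counterexamples) — no Beurling-prime/Euler-product input is used or claimed; the kernel theorem is
about arbitrary sign-definite ℓ¹ Borel families.
- Literature.Barriers.RiemannHypothesis.BohrDenseValues: outside — no value-distribution /
density-of-values input is used; the invisibility results that DO bear on this class are the tree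
blind models B14/B16/B16′ (`ScrewLatticeWolffModel.exists_blind_model`,
`exists_blind_model_discrete`): the line honours them — CEIL alone stays RH-strength (declared
residual) and the conjunct TD is violated by every known blind model (their walls contain circles).
- Negatives index: steers around stmt-RiemannHypothesis-15969/15970 (ShiftedResolvent), 16980
(CharacterSums), 2575 (UniversalFactor) and the screw-neg landed negatives (PivotFloor,
LogFloorTail, ZeroDeficitTail, quadratic-form floors): none concerns aliasedPoleSet / LatticeCeiling
/ Borel walls; no refuted statement is re-wa

sub-problem: RiemannHypothesis · status: draft · opened planner-rh-idea-1-g0-0 2026-08-27T20:19:55Z · rev 0 · ledger route-RiemannHypothesis-ScrewDustWall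
GENERATED by the gate from the ledger (D-0016/17). Provers cite these decls: `theorem foo : Summit.RiemannHypothesis.RiemannHypothesis.Theses.ScrewDustWall.<Decl> := …` in Summits/RiemannHypothesis/RiemannHypothesis/Theorems/<Name>.lean.
-/

namespace Summit.RiemannHypothesis.RiemannHypothesis.Theses.ScrewDustWall

open scoped BigOperators Topology Manifold Classical MeasureTheory ProbabilityTheory Matrix InnerProductSpace ComplexConjugate ContinuousMap
open Filter Set Function TopologicalSpace MeasureTheory

attribute [summit_statement] _root_.Summit.RiemannHypothesis

open Summit

/-- item stmt-RiemannHypothesis-21690 · crux · rank 2 · closed · proved by Summit.RiemannHypothesis.RiemannHypothesis.Theorems.Splittings.ScrewDust.PointComponentInvisible_proof (prover) · by planner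
why it might fail: A point-component admits small wall-avoiding grid cycles only via component = quasi-component in a COMPACT piece of the wall (closedBall r, r<1); Mathlib has no cycle/winding residue calculus — the chain bookkeeping (internal edges cancel) is the real cost.
sources: galaxy:panama:357169480335412, corpus:book:ross2002-generalized-analytic-continuation p36-37, doi:10.1090/ulect/025
[crux] RH-free, ζ-free kernel theorem (the provable content of the line). For a sign-definite ℓ¹
Borel family (Σ‖c_i‖ < ∞, Re c_i < 0, u_i ≠ 0) and F holomorphic on 𝔻 agreeing with the Borel series
Σ term(c_i,u_i) on a small ball around 0 free of poles: if an inside pole p ∈ poleSet u is a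
POINT-COMPONENT of the wall closure(poleSet u) ∩ 𝔻, then p is not adherent to the connected
component of 0 in 𝔻 ∖ closure(poleSet u). Proof plan: F = Borel sum on that component (tree
`eqOn_of_preconnected`); Zoretti/Šura-Bura in the compact set closure(poleSet u) ∩
closedBall((1+‖p‖)/2) gives clopen pieces U ∋ p of diameter → 0; the outer boundary cycle γ of the
grid-square hull of U misses the wall, lies in the 0-component (it is crossed by a path from a point
of the component near p to 0), so ∮_γ F = 0 (squares, Mathlib rectangle Cauchy) while termwise ∮_γ =
−2πi Σ_{q ∈ S ∩ int γ} q·C_q (tree `circleIntegral_term` pattern, uniform convergence off the wall);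
letting diam → 0, Tannery (Σ|C_q| ≤ Σ‖c_i‖) gives p·C_p = 0, contradicting Re C_p < 0 (tree
`re_tsum_poleCoeff_neg`) and p ≠ 0. [difficulty: L] -/
@[route_item "route-RiemannHypothesis-ScrewDustWall", crux]
def PointComponentInvisible : Prop :=
  ∀ {ι : Type} (c u : ι → ℂ), Summable (fun i ↦ ‖c i‖) → (∀ i, (c i).re < 0) → (∀ i, u i ≠ 0) → ∀ F : ℂ → ℂ, DifferentiableOn ℂ F (Metric.ball 0 1) → ∀ r₀ : ℝ, 0 < r₀ → (∀ p ∈ Theorems.Splittings.ScrewBorel.poleSet u, r₀ ≤ ‖p‖) → Set.EqOn F (fun z ↦ ∑' i, Theorems.Splittings.ScrewBorel.term (c i) (u i) z) (Metric.ball 0 r₀) → ∀ p ∈ Theorems.Splittings.ScrewBorel.poleSet u, connectedComponentIn (closure (Theorems.Splittings.ScrewBorel.poleSet u) ∩ Metric.ball 0 1) p ⊆ {p} → p ∉ closure (connectedComponentIn (Metric.ball (0 : ℂ) 1 \ closure (Theorems.Splittings.ScrewBorel.poleSet u)) 0)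

-- `PointComponentInvisible` holds: proved by `Summit.RiemannHypothesis.RiemannHypothesis.Theorems.Splittings.ScrewDust.PointComponentInvisible_proof` (its module imports this route file, so no `_holds` link can be stated here).

/-- item stmt-RiemannHypothesis-21691 · crux · rank 3 · open · by planner
why it might fail: False iff off-line zeros exist AND their folded images accumulate along a non-degenerate continuum inside 𝔻 (infinitely many far zeros with |Re ρ − 1/2| bounded below, clustering in angle); the kernel allows exactly this (B16′ circle wall), ζ-side nothing is known.
sources: corpus:book:ross2002-generalized-analytic-continuation p33, doi:10.1090/ulect/025
[crux] The zero-side conjunct TD(1) «DUST WALL» (the searchable object of the split): the closure of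
the aliased pole field at step h = 1 — the set of e^{∓(ρ−1/2)} inside 𝔻 over nontrivial zeros ρ with
Re ρ ≠ 1/2 — meets the open unit disc in a totally disconnected set. RH-implied (vacuous:
`aliasedPoleSet_eq_empty_of_rh`); also implied by «finitely many off-line zeros», by
CountableClosure (X-9) and by ThinWall (X-10, length zero ⟹ totally disconnected), so X-11 ⊇ X-10 ⊇
X-9. It is NOT claimed provable; it is the conjunct a zero-search instrument can address (a
continuum of folded far zeros is the object to exclude). [difficulty: open-problem] -/
@[route_item "route-RiemannHypothesis-ScrewDustWall", crux]
def DustWall : Prop :=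
  IsTotallyDisconnected (closure (Theorems.Splittings.ScrewLatticeContinuation.aliasedPoleSet 1) ∩ Metric.ball (0 : ℂ) 1)

/-- item stmt-RiemannHypothesis-21692 · support · rank 9 · closed · proved by Summit.RiemannHypothesis.RiemannHypothesis.Theorems.Splittings.ScrewDust.DustDoesNotSeparate_proof (prover) · by planner
sources: corpus:paper:arxiv-math_0303261 p7, corpus:paper:arxiv-1311.5122 p16
[support] Classical plane topology (Sierpiński–Mazurkiewicz–Menger; «a closed zero-dimensional set
does not separate a planar domain»): if T ⊆ ℂ is closed and T ∩ 𝔻 is totally disconnected then 𝔻 ∖ T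
is preconnected. Needed only to identify the origin's component with all of 𝔻 ∖ T so that every
aliased pole is adherent to it. Not in Mathlib; provable via clopen partitions of compact pieces +
grid-polygon hulls + Janiszewski-type gluing, or via path-lifting around finitely many small
polygonal blobs. [difficulty: M] -/
@[route_item "route-RiemannHypothesis-ScrewDustWall", crux]
def DustDoesNotSeparate : Prop :=
  ∀ T : Set ℂ, IsClosed T → IsTotallyDisconnected (T ∩ Metric.ball (0 : ℂ) 1) → IsPreconnected (Metric.ball (0 : ℂ) 1 \ T)

-- `DustDoesNotSeparate` holds: proved by `Summit.RiemannHypothesis.RiemannHypothesis.Theorems.Splittings.ScrewDust.DustDoesNotSeparate_proof` (its module imports this route file, so no `_holds` link can be stated here).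

/-- item stmt-RiemannHypothesis-21693 · support · rank 9 · open · by planner
sources: corpus:book:ross2002-generalized-analytic-continuation p33
[support] RESIDUAL conjunct (declared, NOT attacked by this line; RH-strength inside the real-weight
zero-side class by the blind models B14/B16/B16′ `ScrewLatticeWolffModel.exists_blind_model` /
`exists_blind_model_discrete`): CEIL(1) = LatticeCeiling 1, i.e. for every ε > 0 the screw function
satisfies |Ψ(k)| ≤ K_ε e^{εk} on k ∈ ℕ. RH ⟹ CEIL(1) is in the tree. Same decl as g16's L1 residual
up to the choice h = 1 (dedup by signature intended). [difficulty: open-problem] -/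
@[route_item "route-RiemannHypothesis-ScrewDustWall", crux]
def Ceil : Prop :=
  Theorems.Splittings.ScrewLatticeContinuation.LatticeCeiling 1

/-- item stmt-RiemannHypothesis-21694 · assembly · rank 1 · closed · proved by Summit.RiemannHypothesis.RiemannHypothesis.Theorems.Splittings.ScrewDust.assembly_proof (prover) · by planner
sources: corpus:book:ross2002-generalized-analytic-continuation p36
[assembly] PointComponentInvisible → DustDoesNotSeparate → DustWall → Ceil → RH (provable now; proof
= Sketch.lean `closes`). -/
@[route_item "route-RiemannHypothesis-ScrewDustWall", crux]
def Assembly : Prop :=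
  PointComponentInvisible → DustDoesNotSeparate → DustWall → Ceil → Summit.RiemannHypothesis

-- `Assembly` holds: proved by `Summit.RiemannHypothesis.RiemannHypothesis.Theorems.Splittings.ScrewDust.assembly_proof` (its module imports this route file, so no `_holds` link can be stated here).

/-! D-0027 §2.1 — DECIDING THEOREM (planner-authored via `route open/edit --closes-file`; by planner-rh-idea-1-g0-0 2026-08-27T20:19:55Z):
its hypotheses are this route's items and its conclusion the sub-problem Statement (glue_lint), and it elaborates with this file. -/

@[closes "route-RiemannHypothesis-ScrewDustWall"] theorem closes (h₁ : PointComponentInvisible) (h₂ : DustDoesNotSeparate) (h₃ : DustWall) (h₄ : Ceil)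
    (hA : Assembly) : Summit.RiemannHypothesis :=
  hA h₁ h₂ h₃ h₄

end Summit.RiemannHypothesis.RiemannHypothesis.Theses.ScrewDustWall
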